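import Mathlib
import HarnessLib
import Summits.NavierStokesRegularity.NavierStokesRegularity.Theorems.PoloidalWindowDoorLrcModEntireJetCertFast

/-!
# Route `PoloidalWindowDoor`, item `LrcModEntire` (stmt-NavierStokesRegularity-20428) — certificate checker v3: MERGE-SORT normalisation
# (structural recursion only, kernel-reducible) for the fast interpreter

Cell ns-regularity-ideate, seat ns-poloidal-K2-p3 gen 7 (lead of item 20428; `--supports stmt-NavierStokesRegularity-20428`; definitions reviewed).
Calibration of `…JetCertFast` (≈38 s of kernel time per derivative step of an 80-term law over 66 letters) points at `QMvPoly.normalize` (insertion,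
quadratic in the number of terms) as the remaining cost.  This file replaces it, inside the fast interpreter only, by `normalizeS`: a bottom-up merge
sort on exponent lists (FUEL-bounded structural recursion — no well-founded recursion, so `decide +kernel` reduces it) followed by one pass merging
equal adjacent exponents and dropping zeros; `toMv_normalizeS` (same polynomial).  Interpreter `tderivWordS / combineS / deriveS / certCheckS /
checkTreeS`, soundness `not_localDatum_of_checkTreeS`, and the chunking lemma `localDatum_extendS` — all against the SAME `LocalDatum`, so the (TH)
wiring (`…THCertFast.thLocalDatum`) feeds it unchanged (closers in the sequel `…THCertFast2`).

WHAT THIS IS NOT: not a claim about Navier–Stokes — checker performance plumbing (bears_on LADDER-NS N0, item 20428 `stub_localTHEmpty`). [folklore]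
-/

noncomputable section

-- the summit and its single sub-problem share the name (CONVENTIONS §1), as in every Theorems file
set_option linter.dupNamespace false

namespace Summit.NavierStokesRegularity.NavierStokesRegularity.Theorems.PoloidalWindowDoorLrcModEntireJetCertFast2

open _root_.Topology _root_.Filter Set
open Literature.Analysis.ValidatedNumerics Literature.Analysis.ValidatedNumerics.QMvPoly
open Literature.Analysis.Calculus.MvPoly
open Summit.NavierStokesRegularity.NavierStokesRegularity.Theorems.PoloidalWindowDoorLrcModEntireJetCertDefs
open Summit.NavierStokesRegularity.NavierStokesRegularity.Theorems.PoloidalWindowDoorLrcModEntireJetCertMasked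
open Summit.NavierStokesRegularity.NavierStokesRegularity.Theorems.PoloidalWindowDoorLrcModEntireJetCertTree
open Summit.NavierStokesRegularity.NavierStokesRegularity.Theorems.PoloidalWindowDoorLrcModEntireJetCertFast

variable {E : Type*} [NormedAddCommGroup E] [NormedSpace ℝ E] {n : ℕ}

/-! ### Merge sort on term lists (fuel-bounded structural recursion) -/

/-- Lexicographic `≤` on exponent lists, as a Boolean (structural). [folklore] -/
def lexLe : List ℕ → List ℕ → Bool
  | [], _ => true
  | _ :: _, [] => false
  | a :: l, b :: m => if a < b then true else if b < a then false else lexLe l m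

/-- Merge two term lists (fuel = total length suffices). [folklore] -/
def mergeT : ℕ → QMvPoly → QMvPoly → QMvPoly
  | 0, l₁, l₂ => l₁ ++ l₂
  | _ + 1, [], l₂ => l₂
  | _ + 1, t₁ :: l₁, [] => t₁ :: l₁
  | f + 1, t₁ :: l₁, t₂ :: l₂ =>
      if lexLe t₁.1 t₂.1 then t₁ :: mergeT f l₁ (t₂ :: l₂) else t₂ :: mergeT f (t₁ :: l₁) l₂

/-- `mergeT` is a permutation of the concatenation. [folklore] -/
theorem perm_mergeT : ∀ (f : ℕ) (l₁ l₂ : QMvPoly), (mergeT f l₁ l₂).Perm (l₁ ++ l₂) := by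
  intro f
  induction f with
  | zero => intro l₁ l₂; simp [mergeT]
  | succ f ih =>
    intro l₁ l₂
    cases l₁ with
    | nil => simp [mergeT]
    | cons t₁ l₁ =>
      cases l₂ with
      | nil => simp [mergeT]
      | cons t₂ l₂ =>
        simp only [mergeT]
        split_ifs
        · exact (ih l₁ (t₂ :: l₂)).cons t₁
        · have h := (ih (t₁ :: l₁) l₂).cons t₂
          refine h.trans ?_
          simpa using (List.perm_middle (a := t₂) (l₁ := t₁ :: l₁) (l₂ := l₂)).symm

/-- One bottom-up pass: merge adjacent runs. [folklore] -/
def mergePass : List QMvPoly → List QMvPoly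
  | [] => []
  | [l] => [l]
  | l₁ :: l₂ :: rest => mergeT (l₁.length + l₂.length) l₁ l₂ :: mergePass rest

/-- The flattening of a pass is a permutation of the flattening. [folklore] -/
theorem perm_flatten_mergePass : ∀ ls : List QMvPoly, (mergePass ls).flatten.Perm ls.flatten
  | [] => by simp [mergePass]
  | [l] => by simp [mergePass]
  | l₁ :: l₂ :: rest => by
      simp only [mergePass, List.flatten_cons]
      have h := (perm_mergeT (l₁.length + l₂.length) l₁ l₂).append (perm_flatten_mergePass rest)
      simpa [List.append_assoc] using h

/-- All passes (fuel = number of runs suffices). [folklore] -/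
def mergeAll : ℕ → List QMvPoly → QMvPoly
  | 0, ls => ls.flatten
  | _ + 1, [] => []
  | _ + 1, [l] => l
  | f + 1, l₁ :: l₂ :: rest => mergeAll f (mergePass (l₁ :: l₂ :: rest))

/-- `mergeAll` is a permutation of the flattening. [folklore] -/
theorem perm_mergeAll : ∀ (f : ℕ) (ls : List QMvPoly), (mergeAll f ls).Perm ls.flatten := by
  intro f
  induction f with
  | zero => intro ls; simp [mergeAll]
  | succ f ih =>
    intro ls
    match ls with
    | [] => simp [mergeAll]
    | [l] => simp [mergeAll]
    | l₁ :: l₂ :: rest =>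
      simp only [mergeAll]
      exact (ih _).trans (perm_flatten_mergePass _)

/-- Merge sort of a term list by exponent lists. [folklore] -/
def msort (p : QMvPoly) : QMvPoly := mergeAll p.length (p.map fun t => [t])

/-- Flattening singletons gives back the list. [folklore] -/
theorem flatten_map_singleton : ∀ p : QMvPoly, (p.map fun t => [t]).flatten = p
  | [] => rfl
  | t :: p => by simp [flatten_map_singleton p]

/-- `msort p` is a permutation of `p`. [folklore] -/
theorem perm_msort (p : QMvPoly) : (msort p).Perm p := by
  have h := perm_mergeAll p.length (p.map fun t => [t])
  rw [flatten_map_singleton] at h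
  exact h

/-- Permutations of term lists represent the same polynomial. [folklore] -/
theorem toMv_perm {p q : QMvPoly} (h : p.Perm q) : QMvPoly.toMv ℝ n p = QMvPoly.toMv ℝ n q := by
  unfold QMvPoly.toMv
  exact (h.map _).sum_eq

/-- One pass combining equal adjacent exponents and dropping zero coefficients (fuel-bounded). [folklore] -/
def mergeAdj : ℕ → QMvPoly → QMvPoly
  | 0, l => l
  | _ + 1, [] => []
  | _ + 1, [t] => if t.2 = 0 then [] else [t]
  | f + 1, t₁ :: t₂ :: rest =>
      if t₁.1 = t₂.1 then mergeAdj f ((t₁.1, t₁.2 + t₂.2) :: rest)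
      else if t₁.2 = 0 then mergeAdj f (t₂ :: rest) else t₁ :: mergeAdj f (t₂ :: rest)

/-- `mergeAdj` does not change the polynomial. [folklore] -/
theorem toMv_mergeAdj : ∀ (f : ℕ) (l : QMvPoly), QMvPoly.toMv ℝ n (mergeAdj f l) = QMvPoly.toMv ℝ n l := by
  intro f
  induction f with
  | zero => intro l; rfl
  | succ f ih =>
    intro l
    match l with
    | [] => rfl
    | [t] =>
      simp only [mergeAdj]
      split_ifs with h
      · rw [QMvPoly.toMv_cons, h]; simp
      · rfl
    | t₁ :: t₂ :: rest =>
      simp only [mergeAdj]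
      split_ifs with h1 h2
      · rw [ih, QMvPoly.toMv_cons, QMvPoly.toMv_cons, QMvPoly.toMv_cons, h1, ← add_assoc, ← map_add, Rat.cast_add]
      · rw [ih, QMvPoly.toMv_cons, QMvPoly.toMv_cons, QMvPoly.toMv_cons, h2]; simp
      · rw [QMvPoly.toMv_cons, QMvPoly.toMv_cons, ih, QMvPoly.toMv_cons]

/-- **Sort-based normalisation**: merge sort, then one combining pass. [folklore] -/
def normalizeS (p : QMvPoly) : QMvPoly := mergeAdj (p.length + 1) (msort p)

/-- `normalizeS` does not change the polynomial. [folklore] -/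
theorem toMv_normalizeS (p : QMvPoly) : QMvPoly.toMv ℝ n (normalizeS p) = QMvPoly.toMv ℝ n p := by
  rw [normalizeS, toMv_mergeAdj, toMv_perm (perm_msort p)]

/-- `ev` is unchanged by `normalizeS`. [folklore] -/
theorem ev_normalizeS (p : QMvPoly) (z : EuclideanSpace ℝ (Fin n)) : ev n (normalizeS p) z = ev n p z := by
  simp [ev, toMv_normalizeS]

/-! ### Interpreter v3 -/

/-- Iterated fast derivative, mask-checked, sort-normalised. [folklore] -/
def tderivWordS (n : ℕ) (S : ℕ → ℕ → QMvPoly) (M : ℕ → ℕ → Bool) : List ℕ → QMvPoly → Option QMvPoly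
  | [], p => some p
  | j :: w, p =>
      match tderivWordS n S M w p with
      | none => none
      | some q => if usesOnlyTabled n (M j) q then some (normalizeS (tderivF n (S j) q)) else none

/-- One step. [folklore] -/
def combineS (n : ℕ) (S : ℕ → ℕ → QMvPoly) (M : ℕ → ℕ → Bool) (laws : List QMvPoly)
    (step : List (QMvPoly × ℕ × List ℕ)) : Option QMvPoly :=
  match optFlatten (step.map fun s => (tderivWordS n S M s.2.2 (laws.getD s.2.1 [])).map fun q => QMvPoly.mul s.1 q) with
  | none => none
  | some r => some (normalizeS r)

/-- The interpreter. [folklore] -/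
def deriveS (n : ℕ) (S : ℕ → ℕ → QMvPoly) (M : ℕ → ℕ → Bool) :
    List QMvPoly → List (List (QMvPoly × ℕ × List ℕ)) → Option (List QMvPoly)
  | laws, [] => some laws
  | laws, step :: rest =>
      match combineS n S M laws step with
      | none => none
      | some L => deriveS n S M (laws ++ [L]) rest

/-- ONE BOOLEAN (the final comparison also by `normalizeS`). [folklore] -/
def certCheckS (n : ℕ) (S : ℕ → ℕ → QMvPoly) (M : ℕ → ℕ → Bool) (hyps : List QMvPoly)
    (cert : List (List (QMvPoly × ℕ × List ℕ))) (k : ℕ) (T : QMvPoly) : Bool :=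
  match deriveS n S M hyps cert with
  | none => false
  | some laws => decide (normalizeS (laws.getD k [] ++ QMvPoly.smul (-1) T) = [])

/-- The tree checker v3. [folklore] -/
def checkTreeS (n : ℕ) (S : ℕ → ℕ → QMvPoly) (M : ℕ → ℕ → Bool) : List QMvPoly → List QMvPoly → CertTree → Bool
  | hyps, pins, .leaf cert k e => certCheckS n S M hyps cert k (pinProduct pins e)
  | hyps, pins, .split π nz z => checkTreeS n S M hyps (pins ++ [π]) nz && checkTreeS n S M (hyps ++ [π]) pins z

/-! ### Soundness v3 -/

section Soundness

variable {U : Set E} {g : E → EuclideanSpace ℝ (Fin n)} {v : ℕ → E} {S : ℕ → ℕ → QMvPoly} {M : ℕ → ℕ → Bool}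

/-- [folklore] -/
theorem ev_tderivWordS_eq_zero (hU : IsOpen U) (hg : ∀ x ∈ U, DifferentiableAt ℝ g x)
    (hS : ∀ j, ∀ i : Fin n, M j i = true → ∀ x ∈ U, fderiv ℝ (fun y => g y i) x (v j) = ev n (S j i) (g x))
    {L : QMvPoly} (hL : ∀ x ∈ U, ev n L (g x) = 0) :
    ∀ (w : List ℕ) (q : QMvPoly), tderivWordS n S M w L = some q → ∀ x ∈ U, ev n q (g x) = 0 := by
  intro w
  induction w with
  | nil => intro q hq; simp only [tderivWordS, Option.some.injEq] at hq; subst hq; exact hL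
  | cons j w ih =>
    intro q hq x hx
    simp only [tderivWordS] at hq
    cases hrec : tderivWordS n S M w L with
    | none => simp [hrec] at hq
    | some r =>
      simp only [hrec] at hq
      by_cases hmask : usesOnlyTabled n (M j) r = true
      · simp only [hmask, ↓reduceIte, Option.some.injEq] at hq
        subst hq
        rw [ev_normalizeS]
        exact ev_tderivF_eq_zero_masked hU hg (hS j) (ih r hrec) hmask x hx
      · simp [hmask] at hq

/-- [folklore] -/
theorem ev_combineS_eq_zero (hU : IsOpen U) (hg : ∀ x ∈ U, DifferentiableAt ℝ g x)
    (hS : ∀ j, ∀ i : Fin n, M j i = true → ∀ x ∈ U, fderiv ℝ (fun y => g y i) x (v j) = ev n (S j i) (g x))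
    {laws : List QMvPoly} (hlaws : ∀ L ∈ laws, ∀ x ∈ U, ev n L (g x) = 0) (step : List (QMvPoly × ℕ × List ℕ))
    {r : QMvPoly} (hr : combineS n S M laws step = some r) : ∀ x ∈ U, ev n r (g x) = 0 := by
  intro x hx
  unfold combineS at hr
  split at hr
  · exact absurd hr (by simp)
  · rename_i r' hflat
    simp only [Option.some.injEq] at hr
    subst hr
    rw [ev_normalizeS]
    refine ev_optFlatten_eq_zero _ r' hflat fun q hq => ?_
    obtain ⟨s, -, hs⟩ := List.mem_map.1 hq
    obtain ⟨q', hw, rfl⟩ := Option.map_eq_some_iff.1 hs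
    have hsrc : ∀ y ∈ U, ev n (laws.getD s.2.1 []) (g y) = 0 := by
      intro y hy
      rw [List.getD_eq_getElem?_getD]
      cases h : laws[s.2.1]? with
      | none => simp
      | some L => simpa using hlaws L (List.mem_of_getElem? h) y hy
    rw [ev_mul, ev_tderivWordS_eq_zero hU hg hS hsrc s.2.2 q' hw x hx, mul_zero]

/-- [folklore] -/
theorem ev_deriveS_eq_zero (hU : IsOpen U) (hg : ∀ x ∈ U, DifferentiableAt ℝ g x)
    (hS : ∀ j, ∀ i : Fin n, M j i = true → ∀ x ∈ U, fderiv ℝ (fun y => g y i) x (v j) = ev n (S j i) (g x))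
    (cert : List (List (QMvPoly × ℕ × List ℕ))) :
    ∀ (laws : List QMvPoly), (∀ L ∈ laws, ∀ x ∈ U, ev n L (g x) = 0) →
      ∀ laws', deriveS n S M laws cert = some laws' → ∀ L ∈ laws', ∀ x ∈ U, ev n L (g x) = 0 := by
  induction cert with
  | nil => intro laws hlaws laws' h; simp only [deriveS, Option.some.injEq] at h; subst h; exact hlaws
  | cons step rest ih =>
    intro laws hlaws laws' h
    simp only [deriveS] at h
    cases hc : combineS n S M laws step with
    | none => simp [hc] at h
    | some L =>
      simp only [hc] at h
      refine ih _ (fun L' hL' => ?_) laws' h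
      rcases List.mem_append.1 hL' with h' | h'
      · exact hlaws L' h'
      · rw [List.mem_singleton.1 h']; exact ev_combineS_eq_zero hU hg hS hlaws step hc

/-- A checked certificate proves that its target vanishes on `U`. [folklore] -/
theorem ev_eq_zero_of_certCheckS (hU : IsOpen U) (hg : ∀ x ∈ U, DifferentiableAt ℝ g x)
    (hS : ∀ j, ∀ i : Fin n, M j i = true → ∀ x ∈ U, fderiv ℝ (fun y => g y i) x (v j) = ev n (S j i) (g x))
    {hyps : List QMvPoly} (hhyps : ∀ L ∈ hyps, ∀ x ∈ U, ev n L (g x) = 0)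
    {cert : List (List (QMvPoly × ℕ × List ℕ))} {k : ℕ} {T : QMvPoly} (hcheck : certCheckS n S M hyps cert k T = true) :
    ∀ x ∈ U, ev n T (g x) = 0 := by
  intro x hx
  simp only [certCheckS] at hcheck
  cases hd : deriveS n S M hyps cert with
  | none => simp [hd] at hcheck
  | some laws =>
    simp only [hd, decide_eq_true_eq] at hcheck
    have hlaw : ev n (laws.getD k []) (g x) = 0 := by
      rw [List.getD_eq_getElem?_getD]
      cases h : laws[k]? with
      | none => simp
      | some L => simpa using ev_deriveS_eq_zero hU hg hS cert hyps hhyps laws hd L (List.mem_of_getElem? h) x hx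
    have hdiff : ev n (laws.getD k [] ++ QMvPoly.smul (-1) T) (g x) = 0 := by
      rw [← ev_normalizeS, hcheck, ev_nil]
    rw [ev_append, ev_smul, hlaw] at hdiff
    simpa using hdiff

end Soundness

/-- **CHUNKING v3**: a certified law joins the hypotheses of a local datum. [folklore] -/
theorem localDatum_extendS {S : ℕ → ℕ → QMvPoly} {M : ℕ → ℕ → Bool} {v : ℕ → E} {hyps pins : List QMvPoly}
    (hdat : LocalDatum n S M v hyps pins) {cert : List (List (QMvPoly × ℕ × List ℕ))} {k : ℕ} {T : QMvPoly}
    (hcheck : certCheckS n S M hyps cert k T = true) : LocalDatum n S M v (hyps ++ [T]) pins := by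
  obtain ⟨U, p₀, g, hU, hp₀, hg, hS, hhyps, hpins⟩ := hdat
  refine ⟨U, p₀, g, hU, hp₀, hg, hS, ?_, hpins⟩
  intro L hL x hx
  rcases List.mem_append.1 hL with h | h
  · exact hhyps L h x hx
  · rw [List.mem_singleton.1 h]; exact ev_eq_zero_of_certCheckS hU hg hS hhyps hcheck x hx

/-- **SOUNDNESS OF v3 CERTIFICATE TREES.** [folklore] -/
theorem not_localDatum_of_checkTreeS {S : ℕ → ℕ → QMvPoly} {M : ℕ → ℕ → Bool} {v : ℕ → E} :
    ∀ (t : CertTree) (hyps pins : List QMvPoly), checkTreeS n S M hyps pins t = true → ¬ LocalDatum n S M v hyps pins := by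
  intro t
  induction t with
  | leaf cert k e =>
    intro hyps pins hcheck hdat
    have hdat' := hdat
    obtain ⟨U, p₀, g, hU, hp₀, hg, hS, hhyps, hpins⟩ := hdat
    simp only [checkTreeS] at hcheck
    exact ev_pinProduct_ne_zero (g p₀) pins e hpins (ev_eq_zero_of_certCheckS hU hg hS hhyps hcheck p₀ hp₀)
  | split π nz z ihnz ihz =>
    intro hyps pins hcheck hdat
    simp only [checkTreeS, Bool.and_eq_true] at hcheck
    obtain ⟨hc1, hc2⟩ := hcheck
    obtain ⟨U, p₀, g, hU, hp₀, hg, hS, hhyps, hpins⟩ := hdat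
    by_cases hzero : ∃ V : Set E, IsOpen V ∧ p₀ ∈ V ∧ ∀ x ∈ V, ev n π (g x) = 0
    · obtain ⟨V, hV, hp₀V, hπ⟩ := hzero
      refine ihz (hyps ++ [π]) pins hc2 ⟨U ∩ V, p₀, g, hU.inter hV, ⟨hp₀, hp₀V⟩, fun x hx => hg x hx.1,
        fun j i hi x hx => hS j i hi x hx.1, ?_, hpins⟩
      intro L hL x hx
      rcases List.mem_append.1 hL with h | h
      · exact hhyps L h x hx.1
      · rw [List.mem_singleton.1 h]; exact hπ x hx.2
    · push Not at hzero
      set N : Set E := U ∩ ⋂ π' ∈ pins, {x | ev n π' (g x) ≠ 0} with hN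
      have hNnhds : N ∈ 𝓝 p₀ := by
        refine Filter.inter_mem (hU.mem_nhds hp₀) ?_
        refine (Filter.biInter_mem (List.finite_toSet pins)).2 fun π' hπ' => ?_
        exact (continuousAt_ev_comp (hg p₀ hp₀) π').eventually_ne (hpins π' hπ')
      obtain ⟨V, hVN, hVo, hp₀V⟩ := mem_nhds_iff.1 hNnhds
      obtain ⟨p₁, hp₁V, hp₁⟩ := hzero V hVo hp₀V
      have hp₁N : p₁ ∈ N := hVN hp₁V
      refine ihnz hyps (pins ++ [π]) hc1 ⟨U, p₁, g, hU, hp₁N.1, hg, hS, hhyps, ?_⟩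
      intro π' hπ'
      rcases List.mem_append.1 hπ' with h | h
      · exact (Set.mem_iInter₂.1 hp₁N.2) π' h
      · rw [List.mem_singleton.1 h]; exact hp₁

/-- Self-test (`decide +kernel`): the tree example checks with v3. [folklore] -/
theorem example_checkTreeS :
    checkTreeS 3 exampleTableM exampleMaskM
      [QMvPoly.mul (QMvPoly.var 3 0) (QMvPoly.var 3 1), QMvPoly.var 3 2 ++ QMvPoly.smul (-1) (QMvPoly.var 3 0)]
      [QMvPoly.var 3 0]
      (.split (QMvPoly.var 3 1)
        (.leaf [[(QMvPoly.const 1, 0, [])]] 2 [1, 1])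
        (.leaf [[(QMvPoly.const 1, 2, [0])], [(QMvPoly.const (-1), 1, []), (QMvPoly.const 1, 3, [])]] 4 [1])) = true := by
  decide +kernel

end Summit.NavierStokesRegularity.NavierStokesRegularity.Theorems.PoloidalWindowDoorLrcModEntireJetCertFast2

end
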